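import Summits.MatrixMultiplication.MatrixMultiplication.Theorems.ObstructionDescentPolarLadder
import Summits.MatrixMultiplication.MatrixMultiplication.Theorems.ObstructionDescentSlotSymmetry
import Summits.MatrixMultiplication.MatrixMultiplication.Theorems.ObstructionDescentIrreducibleTypes

set_option linter.dupNamespace false

/-!
# Obstruction descent — DOMINANCE: live types are non-decreasing, and the `E`-family certificate

`route-MatrixMultiplication-ObstructionDescent`, crux `NoOccurrenceObstruction` (stmt 29040); decomp-mm lens-3, NODE-g27 §4.

**Theorem (`monotone_of_hwvSpace_ne_bot`).**  If the space `hwvSpace Λ d` of weight vectors of type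
`Λ = (λ⁽⁰⁾,λ⁽¹⁾,λ⁽²⁾)` in degree `d` is non-zero, then each exponent vector `λ⁽ˢ⁾ : Fin m → ℕ` is MONOTONE
(non-decreasing along `Fin m`).  With the weight law `Σ_a λ⁽ˢ⁾_a = d` (`ObstructionDescentIrreducibleTypes`) this says
that the live types are triples of partitions of `d` read along the Borel order — the dominance condition on highest
weights, proved inside the polynomial model of the tree (no Lie theory imported; no definitions declared).

**Proof (slot 0; slots 1, 2 by the slot symmetry `rename (slotPerm σ)` of `ObstructionDescentSlotSymmetry`).**  Fix `i < j`
and the polarisation operator `D_{i→j} = Σ_q x_{(j,q)} ∂_{(i,q)}` of `ObstructionDescentPolarLadder`.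
* §1  INVARIANCE `⇒ D_{i→j} f = 0` (`polar_eq_zero_of_mem_hwvSpace`): the root subgroup `u = 1 + x E_{ij}` lies in the
  Borel with trivial character, so `f(u·t) = f(t)`; the restriction of `f` to the line `x ↦ u(x)·t` is a constant
  univariate polynomial, and its derivative at `0` — computed by the chain rule `derivative_aeval` — is `(D_{i→j} f)(t)`.
* §2  A weight vector is slice-homogeneous of slice weights `λ⁽⁰⁾_a` (`isWeightedHomogeneous_slice_of_mem_hwvSpace`), so
  the `sl₂` LADDER `ObstructionDescentPolarLadder.le_of_polar_eq_zero` gives `λ⁽⁰⁾_i ≤ λ⁽⁰⁾_j`.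
* §3  APPLICATION (`blockType_irreducible`): the block types `E_L = ((L-1)^L, (L^{L-1}), ·)` admit no splitting into
  two live types of positive degrees — they are certified GENUINE obligations of the irreducible-types reduction
  `ObstructionDescentIrreducibleTypes.unitSaturation_of_irreducible` (NODE-g27 §2: `g(E_L) = 1, 1, 6` for `L = 3, 4, 5`).

[cite: BurgisserIkenmeyer2011, §3.1–3.2] (highest weight vectors; their types are triples of partitions)
[cite: LandsbergGCT2017, §7.1] [folklore: `sl₂` ladder / dominance of highest weights]
-/

noncomputable section

open scoped BigOperators

namespace Summit.MatrixMultiplication.MatrixMultiplication.Theorems.ObstructionDescentDominance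

open Literature.Computability.AlgebraicComplexity (actTensor actTensor_apply)
open Summit.MatrixMultiplication.MatrixMultiplication.Theorems.ObstructionCalculus
open Summit.MatrixMultiplication.MatrixMultiplication.Theorems.ObstructionDescentPolarLadder (le_of_polar_eq_zero)
open MvPolynomial (pderiv X)

variable {m : ℕ}

/-! ### §1 Invariance under the root subgroup `1 + x·E_{ij}` forces `D_{i→j} f = 0` -/

/-- `(A ⊗ 1 ⊗ 1)·t` in coordinates. [bookkeeping] -/
theorem actTensor_one_one_apply (A : Matrix (Fin m) (Fin m) ℂ) (t : Tensor ℂ m) (a b c : Fin m) :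
    actTensor A 1 1 t a b c = ∑ a', A a a' * t a' b c := by
  rw [actTensor_apply]
  refine Finset.sum_congr rfl fun a' _ => ?_
  rw [Finset.sum_eq_single b (fun b' _ hb' => by simp [Matrix.one_apply_ne' hb'])
    (fun h => absurd (Finset.mem_univ _) h),
    Finset.sum_eq_single c (fun c' _ hc' => by simp [Matrix.one_apply_ne' hc'])
    (fun h => absurd (Finset.mem_univ _) h)]
  simp

/-- Entries of the root subgroup element `u_{ij}(x) = 1 + x·E_{ij}`. [bookkeeping] -/
theorem shear_apply (i j : Fin m) (x : ℂ) (a a' : Fin m) :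
    (1 + x • Matrix.single i j (1 : ℂ)) a a' = (if a = a' then 1 else 0) + (if i = a ∧ j = a' then x else 0) := by
  simp only [Matrix.add_apply, Matrix.one_apply, Matrix.smul_apply, Matrix.single_apply, smul_eq_mul,
    mul_ite, mul_one, mul_zero]

/-- For `i < j` the root element is upper unitriangular: in the Borel, with trivial character. [bookkeeping] -/
theorem shear_mem_borel {i j : Fin m} (hij : i < j) (x : ℂ) :
    (1 + x • Matrix.single i j (1 : ℂ)) ∈ borel m := by
  refine ⟨fun a a' h => ?_, fun a => ?_⟩
  · rw [shear_apply, if_neg (ne_of_gt h), zero_add, if_neg]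
    rintro ⟨rfl, rfl⟩
    exact lt_asymm hij h
  · rw [shear_apply, if_pos rfl, if_neg, add_zero]
    · exact one_ne_zero
    · rintro ⟨rfl, h⟩
      exact (ne_of_lt hij) h.symm

/-- The root element has trivial Borel character. [bookkeeping] -/
theorem weightChar_shear {i j : Fin m} (hij : i ≠ j) (x : ℂ) (lam : Fin m → ℕ) :
    weightChar lam (1 + x • Matrix.single i j (1 : ℂ)) = 1 := by
  unfold weightChar
  refine Finset.prod_eq_one fun a _ => ?_
  rw [shear_apply, if_pos rfl, if_neg, add_zero, one_pow]
  rintro ⟨rfl, h⟩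
  exact hij h.symm

/-- The root element acts by the slice shear `t ↦ t + x·(slice j placed in slice i)`. [bookkeeping] -/
theorem actTensor_shear (i j : Fin m) (x : ℂ) (t : Tensor ℂ m) :
    actTensor (1 + x • Matrix.single i j (1 : ℂ)) 1 1 t = t + x • fun a b c => if i = a then t j b c else 0 := by
  funext a b c
  rw [actTensor_one_one_apply]
  simp only [shear_apply, add_mul, Finset.sum_add_distrib, ite_mul, one_mul, zero_mul, Finset.sum_ite_eq,
    Finset.mem_univ, if_true]
  have h2 : (∑ a' : Fin m, if i = a ∧ j = a' then x * t a' b c else 0) = x * if i = a then t j b c else 0 := by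
    by_cases hia : i = a
    · simp only [hia, true_and, if_true]
      rw [Finset.sum_ite_eq]; simp
    · simp [hia]
  rw [h2]
  simp only [Pi.add_apply, Pi.smul_apply, smul_eq_mul]

/-- **Invariance:** a weight vector is invariant under the slice shears `u_{ij}(x)`, `i < j`.
[cite: BurgisserIkenmeyer2011, §3.1] -/
theorem evalT_shear_of_mem_hwvSpace {Λ : Fin 3 → Fin m → ℕ} {d : ℕ} {f : MvPolynomial (Idx m) ℂ}
    (hf : f ∈ hwvSpace Λ d) {i j : Fin m} (hij : i < j) (x : ℂ) (t : Tensor ℂ m) :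
    evalT (t + x • fun a b c => if i = a then t j b c else 0) f = evalT t f := by
  have h := hf.2 (1 + x • Matrix.single i j (1 : ℂ)) 1 1 (shear_mem_borel hij x) one_mem_borel one_mem_borel t
  rwa [weightChar_shear (ne_of_lt hij), weightChar_one, weightChar_one, one_mul, one_mul, one_mul,
    actTensor_shear] at h

/-- **Chain rule** for the substitution of univariate polynomials into a multivariate one. [folklore] -/
theorem derivative_aeval (g : Idx m → Polynomial ℂ) (f : MvPolynomial (Idx m) ℂ) :
    Polynomial.derivative (MvPolynomial.aeval g f) =
      ∑ p : Idx m, MvPolynomial.aeval g (pderiv p f) * Polynomial.derivative (g p) := by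
  classical
  induction f using MvPolynomial.induction_on with
  | C a => simp
  | add p q hp hq => simp only [map_add, hp, hq, add_mul, Finset.sum_add_distrib]
  | mul_X p q hp =>
    have hX : ∀ p' : Idx m, MvPolynomial.aeval g (pderiv p' (X q : MvPolynomial (Idx m) ℂ)) =
        if p' = q then 1 else 0 := by
      intro p'
      by_cases h : p' = q
      · rw [if_pos h, h, MvPolynomial.pderiv_X_self, map_one]
      · rw [if_neg h, MvPolynomial.pderiv_X_of_ne (Ne.symm h), map_zero]
    have hterm : ∀ p' : Idx m,
        MvPolynomial.aeval g (pderiv p' (p * X q)) * Polynomial.derivative (g p') =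
          MvPolynomial.aeval g (pderiv p' p) * Polynomial.derivative (g p') * g q +
            (if p' = q then MvPolynomial.aeval g p * Polynomial.derivative (g p') else 0) := by
      intro p'
      rw [MvPolynomial.pderiv_mul, map_add, map_mul, map_mul, MvPolynomial.aeval_X, hX]
      split_ifs <;> ring
    rw [map_mul, MvPolynomial.aeval_X, Polynomial.derivative_mul, hp, Finset.sum_mul,
      Finset.sum_congr rfl (fun p' _ => hterm p'), Finset.sum_add_distrib, Finset.sum_ite_eq' Finset.univ q,
      if_pos (Finset.mem_univ q)]

/-- **Restriction to a line is a univariate polynomial:** `u ↦ f(t + u·v)` is `eval u` of the substitution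
`x_p ↦ t_p + v_p·X`. [folklore] -/
theorem eval_aeval_line (t v : Tensor ℂ m) (f : MvPolynomial (Idx m) ℂ) (u : ℂ) :
    Polynomial.eval u (MvPolynomial.aeval (fun p : Idx m =>
      Polynomial.C (t p.1 p.2.1 p.2.2) + Polynomial.C (v p.1 p.2.1 p.2.2) * Polynomial.X) f) =
      evalT (t + u • v) f := by
  rw [← Polynomial.coe_aeval_eq_eval, ← AlgHom.comp_apply, MvPolynomial.comp_aeval]
  unfold evalT
  refine congrArg (fun g : Idx m → ℂ => MvPolynomial.aeval g f) (funext fun p => ?_)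
  simp only [map_add, map_mul, Polynomial.aeval_C, Polynomial.aeval_X, Algebra.algebraMap_self_apply,
    Pi.add_apply, Pi.smul_apply, smul_eq_mul]
  ring

/-- `x_p(t) = t_p`. [bookkeeping] -/
theorem evalT_X (t : Tensor ℂ m) (p : Idx m) : evalT t (X p) = t p.1 p.2.1 p.2.2 :=
  MvPolynomial.aeval_X _ _

/-- `(D_{i→j} f)(t) = Σ_q t_{(j,q)}·(∂_{(i,q)} f)(t)`. [bookkeeping] -/
theorem evalT_polar (i j : Fin m) (t : Tensor ℂ m) (f : MvPolynomial (Idx m) ℂ) :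
    evalT t (∑ q : Fin m × Fin m, X ((j, q) : Idx m) * pderiv ((i, q) : Idx m) f) =
      ∑ q : Fin m × Fin m, t j q.1 q.2 * evalT t (pderiv ((i, q) : Idx m) f) := by
  rw [map_sum]
  exact Finset.sum_congr rfl fun q _ => by rw [map_mul, evalT_X]

/-- **Infinitesimal invariance:** `D_{i→j} f = 0` for every weight vector `f` and `i < j` — the derivative at
`x = 0` of the constant function `x ↦ f(u_{ij}(x)·t)`. [cite: BurgisserIkenmeyer2011, §3.1] [folklore] -/
theorem polar_eq_zero_of_mem_hwvSpace {Λ : Fin 3 → Fin m → ℕ} {d : ℕ} {f : MvPolynomial (Idx m) ℂ}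
    (hf : f ∈ hwvSpace Λ d) {i j : Fin m} (hij : i < j) :
    (∑ q : Fin m × Fin m, X ((j, q) : Idx m) * pderiv ((i, q) : Idx m) f) = 0 := by
  classical
  have key : ∀ t : Tensor ℂ m, evalT t (∑ q : Fin m × Fin m, X ((j, q) : Idx m) * pderiv ((i, q) : Idx m) f) = 0 := by
    intro t
    obtain ⟨v, hv⟩ : ∃ v : Tensor ℂ m, v = fun a b c => if i = a then t j b c else 0 := ⟨_, rfl⟩
    have hinv : ∀ u : ℂ, evalT (t + u • v) f = evalT t f := fun u => by
      rw [hv]; exact evalT_shear_of_mem_hwvSpace hf hij u t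
    have hQ : MvPolynomial.aeval (fun p : Idx m => Polynomial.C (t p.1 p.2.1 p.2.2) +
        Polynomial.C (v p.1 p.2.1 p.2.2) * Polynomial.X) f = Polynomial.C (evalT t f) := by
      refine Polynomial.funext fun u => ?_
      rw [Polynomial.eval_C, eval_aeval_line, hinv]
    have hder := derivative_aeval (fun p : Idx m => Polynomial.C (t p.1 p.2.1 p.2.2) +
        Polynomial.C (v p.1 p.2.1 p.2.2) * Polynomial.X) f
    have hd' : ∀ p : Idx m, Polynomial.derivative (Polynomial.C (t p.1 p.2.1 p.2.2) +
        Polynomial.C (v p.1 p.2.1 p.2.2) * Polynomial.X) = Polynomial.C (v p.1 p.2.1 p.2.2) := fun p => by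
      rw [Polynomial.derivative_add, Polynomial.derivative_C, Polynomial.derivative_C_mul_X, zero_add]
    rw [hQ, Polynomial.derivative_C] at hder
    simp only [hd'] at hder
    have h0 := congrArg (Polynomial.eval 0) hder
    rw [Polynomial.eval_zero, Polynomial.eval_finsetSum] at h0
    simp only [Polynomial.eval_mul, Polynomial.eval_C, eval_aeval_line, zero_smul, add_zero] at h0
    have h1 : (∑ p : Idx m, evalT t (pderiv p f) * v p.1 p.2.1 p.2.2) =
        ∑ q : Fin m × Fin m, t j q.1 q.2 * evalT t (pderiv ((i, q) : Idx m) f) := by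
      conv_lhs => rw [Fintype.sum_prod_type]
      dsimp only
      rw [Finset.sum_eq_single_of_mem i (Finset.mem_univ i)]
      · refine Finset.sum_congr rfl fun q _ => ?_
        have : v i q.1 q.2 = t j q.1 q.2 := by simp only [hv, if_true]
        rw [this, mul_comm]
      · intro a' _ ha'
        refine Finset.sum_eq_zero fun q _ => ?_
        have hia' : i ≠ a' := Ne.symm ha'
        have : v a' q.1 q.2 = 0 := by simp only [hv, hia', if_false]
        rw [this, mul_zero]
    rw [evalT_polar, ← h1]
    exact h0.symm
  refine MvPolynomial.funext fun x => ?_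
  rw [eval_eq_evalT, map_zero]
  exact key _

/-! ### §2 Dominance: live types are monotone (partitions along the Borel order) -/

/-- **Weight law ⇒ slice homogeneity.**  A weight vector of type `Λ` is weighted-homogeneous of degree `λ⁽⁰⁾_a` for
the slice weight `𝟙[p₀ = a]`. [cite: BurgisserIkenmeyer2011, §3.1] -/
theorem isWeightedHomogeneous_slice_of_mem_hwvSpace {Λ : Fin 3 → Fin m → ℕ} {d : ℕ}
    {f : MvPolynomial (Idx m) ℂ} (hf : f ∈ hwvSpace Λ d) (a : Fin m) :
    MvPolynomial.IsWeightedHomogeneous (fun p : Idx m => if p.1 = a then (1 : ℕ) else 0) f (Λ 0 a) := by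
  classical
  intro μ hμ
  have hμ' : μ ∈ f.support := MvPolynomial.mem_support_iff.mpr hμ
  rw [← (sliceSum_eq_of_mem_support hf hμ' a).1, Finsupp.weight_apply, Finsupp.sum, Finset.sum_filter]
  refine Finset.sum_congr rfl fun p _ => ?_
  simp only [smul_eq_mul, mul_ite, mul_one, mul_zero]


/-- **Dominance in slot 0:** for a non-zero weight vector of type `Λ`, `λ⁽⁰⁾` is non-decreasing.
[cite: BurgisserIkenmeyer2011, §3.1–3.2] -/
theorem slot0_le_of_mem_hwvSpace {Λ : Fin 3 → Fin m → ℕ} {d : ℕ} {f : MvPolynomial (Idx m) ℂ}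
    (hf : f ∈ hwvSpace Λ d) (hf0 : f ≠ 0) {i j : Fin m} (hij : i ≤ j) : Λ 0 i ≤ Λ 0 j := by
  rcases hij.eq_or_lt with rfl | hlt
  · exact le_rfl
  · exact le_of_polar_eq_zero (P := fun i j f => ∑ q : Fin m × Fin m, X ((j, q) : Idx m) * pderiv ((i, q) : Idx m) f)
      (fun _ _ _ => rfl) (ne_of_lt hlt) hf0 (isWeightedHomogeneous_slice_of_mem_hwvSpace hf i)
      (isWeightedHomogeneous_slice_of_mem_hwvSpace hf j) (polar_eq_zero_of_mem_hwvSpace hf hlt)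

/-- **Dominance, all slots** (transport by the slot symmetry `rename (slotPerm (swap 0 s))`).
[cite: BurgisserIkenmeyer2011, §3.1–3.2] -/
theorem monotone_of_mem_hwvSpace {Λ : Fin 3 → Fin m → ℕ} {d : ℕ} {f : MvPolynomial (Idx m) ℂ}
    (hf : f ∈ hwvSpace Λ d) (hf0 : f ≠ 0) (s : Fin 3) : Monotone (Λ s) := by
  intro i j hij
  have hg := rename_slotPerm_mem_hwvSpace hf (Equiv.swap 0 s)
  have hg0 : MvPolynomial.rename (slotPerm (Equiv.swap 0 s)) f ≠ 0 := by
    intro h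
    apply hf0
    rw [← rename_slotPerm_inv_rename (Equiv.swap 0 s) f, h, map_zero]
  have h := slot0_le_of_mem_hwvSpace hg hg0 hij
  simpa only [Equiv.swap_apply_left] using h

/-- **DOMINANCE THEOREM.**  If `hwvSpace Λ d ≠ ⊥` then every `λ⁽ˢ⁾` is monotone: the live types of the obstruction
calculus are triples of partitions (read along the Borel order; with `Σ_a λ⁽ˢ⁾_a = d` by the weight law).
[cite: BurgisserIkenmeyer2011, §3.1–3.2] [cite: LandsbergGCT2017, §7.1] -/
theorem monotone_of_hwvSpace_ne_bot {Λ : Fin 3 → Fin m → ℕ} {d : ℕ} (h : hwvSpace Λ d ≠ ⊥) (s : Fin 3) :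
    Monotone (Λ s) := by
  obtain ⟨f, hf, hf0⟩ := (Submodule.ne_bot_iff _).mp h
  exact monotone_of_mem_hwvSpace hf hf0 s

/-- Corollary: the support of a live exponent vector is a final segment of `Fin m`. [this node] -/
theorem ne_zero_of_le_of_hwvSpace_ne_bot {Λ : Fin 3 → Fin m → ℕ} {d : ℕ} (h : hwvSpace Λ d ≠ ⊥) (s : Fin 3)
    {a b : Fin m} (hab : a ≤ b) (ha : Λ s a ≠ 0) : Λ s b ≠ 0 :=
  fun hb => ha (Nat.eq_zero_of_le_zero (hb ▸ monotone_of_hwvSpace_ne_bot h s hab))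

/-- Corollary: a live exponent vector is bounded by its last entry, `λ⁽ˢ⁾_a ≤ λ⁽ˢ⁾_b` for `a ≤ b`; in particular no
entry exceeds the entry at any later index. [this node] -/
theorem apply_le_apply_of_hwvSpace_ne_bot {Λ : Fin 3 → Fin m → ℕ} {d : ℕ} (h : hwvSpace Λ d ≠ ⊥) (s : Fin 3)
    {a b : Fin m} (hab : a ≤ b) : Λ s a ≤ Λ s b :=
  monotone_of_hwvSpace_ne_bot h s hab

/-! ### §3 Application: constant-block types split only trivially (the `E`-family of genuine obligations)

With the slot-sum law `Σ_a λ⁽ˢ⁾_a = d` (`ObstructionDescentIrreducibleTypes.sum_eq_degree_of_hwvSpace_ne_bot`) dominance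
decides the irreducibility hypothesis of `unitSaturation_of_irreducible` for the BLOCK TYPES
`E_L = ((L-1)^L, (L^{L-1}), ·)` (zero-padded inside `Fin m`): a live splitting `Λ₁ + Λ₂ = E_L` has monotone summands,
hence summands constant on each block, so `d₁ = L·α = (L-1)·β` with `β ≤ L`, forcing `β ∈ {0, L}` and `d₁ ∈ {0, L(L-1)}`.
So every `E_L` (`L ≥ 2`) is a genuine member of the finite list of window types on which the saturation crux must be
checked directly (NODE-g27 §2: `g(E_L) = 1, 1, 6` for `L = 3, 4, 5`). -/

section BlockTypes

open Summit.MatrixMultiplication.MatrixMultiplication.Theorems.ObstructionDescentIrreducibleTypes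
  (sum_eq_degree_of_hwvSpace_ne_bot)

/-- Monotone summands are constant where their sum is. [bookkeeping] -/
theorem eq_of_monotone_add {u v : Fin m → ℕ} (hu : Monotone u) (hv : Monotone v) {a b : Fin m}
    (h : u a + v a = u b + v b) : u a = u b := by
  rcases le_total a b with hab | hab
  · have h1 := hu hab; have h2 := hv hab; omega
  · have h1 := hu hab; have h2 := hv hab; omega

/-- **Block lemma.**  If `u + v = w` with `u, v` monotone and `w ∈ {0, c}` pointwise, then `u` is a constant `α ≤ c` on
the support of `w` and vanishes off it: `Σ_a u_a = #supp(w) · α`. [this node] -/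
theorem sum_eq_card_mul_of_block {u v w : Fin m → ℕ} (hu : Monotone u) (hv : Monotone v)
    (huv : ∀ a, u a + v a = w a) {c : ℕ} (hw : ∀ a, w a ≠ 0 → w a = c) :
    ∃ α, α ≤ c ∧ ∑ a, u a = (Finset.univ.filter fun a => w a ≠ 0).card * α := by
  classical
  have hzero : ∀ a, w a = 0 → u a = 0 := fun a ha => by have := huv a; omega
  by_cases hS : (Finset.univ.filter fun a => w a ≠ 0).Nonempty
  · obtain ⟨a₀, ha₀⟩ := hS
    have ha₀' : w a₀ ≠ 0 := (Finset.mem_filter.mp ha₀).2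
    have hconst : ∀ a, w a ≠ 0 → u a = u a₀ := fun a ha =>
      eq_of_monotone_add hu hv (by rw [huv, huv, hw a ha, hw a₀ ha₀'])
    refine ⟨u a₀, ?_, ?_⟩
    · have := huv a₀; have := hw a₀ ha₀'; omega
    · rw [← Finset.sum_filter_add_sum_filter_not Finset.univ (fun a => w a ≠ 0),
        Finset.sum_const_nat (fun a ha => hconst a (Finset.mem_filter.mp ha).2),
        Finset.sum_eq_zero (fun a ha => hzero a (not_not.mp (Finset.mem_filter.mp ha).2)), add_zero]
  · refine ⟨0, Nat.zero_le _, ?_⟩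
    rw [Finset.not_nonempty_iff_eq_empty.mp hS, Finset.card_empty, zero_mul]
    refine Finset.sum_eq_zero fun a _ => hzero a ?_
    by_contra h
    exact hS ⟨a, Finset.mem_filter.mpr ⟨Finset.mem_univ _, h⟩⟩

/-- **`E`-family certificate.**  A block type `Λ` with `λ⁽⁰⁾ ∈ {0, L-1}^m` supported on `L` indices and
`λ⁽¹⁾ ∈ {0, L}^m` supported on `L - 1` indices (`L ≥ 2`; slot `2` arbitrary) admits no splitting `Λ = Λ₁ + Λ₂` into two
LIVE types of positive degrees — the irreducibility hypothesis of `unitSaturation_of_irreducible` holds at `Λ` in every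
degree. [this node] -/
theorem blockType_irreducible {L : ℕ} (hL : 2 ≤ L) {Λ : Fin 3 → Fin m → ℕ}
    (hval0 : ∀ a, Λ 0 a ≠ 0 → Λ 0 a = L - 1) (hcard0 : (Finset.univ.filter fun a => Λ 0 a ≠ 0).card = L)
    (hval1 : ∀ a, Λ 1 a ≠ 0 → Λ 1 a = L) (hcard1 : (Finset.univ.filter fun a => Λ 1 a ≠ 0).card = L - 1)
    (Λ₁ Λ₂ : Fin 3 → Fin m → ℕ) (d₁ d₂ : ℕ) (hsum : Λ₁ + Λ₂ = Λ)
    (hne₁ : hwvSpace Λ₁ d₁ ≠ ⊥) (hne₂ : hwvSpace Λ₂ d₂ ≠ ⊥) : d₁ = 0 ∨ d₂ = 0 := by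
  classical
  have huv : ∀ s a, Λ₁ s a + Λ₂ s a = Λ s a := fun s a => by rw [← hsum]; rfl
  have hvu : ∀ s a, Λ₂ s a + Λ₁ s a = Λ s a := fun s a => by rw [add_comm]; exact huv s a
  have m₁ := monotone_of_hwvSpace_ne_bot hne₁
  have m₂ := monotone_of_hwvSpace_ne_bot hne₂
  -- slot sums of the two pieces
  obtain ⟨α, -, hα⟩ := sum_eq_card_mul_of_block (m₁ 0) (m₂ 0) (huv 0) hval0
  obtain ⟨β, hβL, hβ⟩ := sum_eq_card_mul_of_block (m₁ 1) (m₂ 1) (huv 1) hval1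
  obtain ⟨α', -, hα'⟩ := sum_eq_card_mul_of_block (m₂ 0) (m₁ 0) (hvu 0) hval0
  rw [hcard0, sum_eq_degree_of_hwvSpace_ne_bot hne₁ 0] at hα
  rw [hcard1, sum_eq_degree_of_hwvSpace_ne_bot hne₁ 1] at hβ
  rw [hcard0, sum_eq_degree_of_hwvSpace_ne_bot hne₂ 0] at hα'
  -- the total degree: `Σ_a λ⁽⁰⁾_a = L (L - 1)`
  have htot : d₁ + d₂ = L * (L - 1) := by
    rw [← sum_eq_degree_of_hwvSpace_ne_bot hne₁ 0, ← sum_eq_degree_of_hwvSpace_ne_bot hne₂ 0,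
      ← Finset.sum_add_distrib, Finset.sum_congr rfl (fun a _ => huv 0 a),
      ← Finset.sum_filter_add_sum_filter_not Finset.univ (fun a => Λ 0 a ≠ 0),
      Finset.sum_const_nat (fun a ha => hval0 a (Finset.mem_filter.mp ha).2),
      Finset.sum_eq_zero (fun a ha => not_not.mp (Finset.mem_filter.mp ha).2), add_zero, hcard0]
  -- arithmetic: `L α = (L-1) β`, `β ≤ L`, `L ≥ 2` ⇒ `β ∈ {0, L}`
  obtain ⟨K, rfl⟩ : ∃ K, L = K + 1 := Nat.exists_eq_succ_of_ne_zero (by omega)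
  simp only [Nat.add_sub_cancel] at hβ htot hval0
  -- hα : d₁ = (K+1) α ; hβ : d₁ = K β
  have e1 : (K + 1) * β = (K + 1) * α + β := by
    calc (K + 1) * β = K * β + β := by ring
      _ = (K + 1) * α + β := by rw [← hβ, hα]
  have e2 : β = (K + 1) * (β - α) := by rw [Nat.mul_sub]; omega
  have hβ0L : β = 0 ∨ β = K + 1 := by
    rcases Nat.eq_zero_or_pos (β - α) with h0 | hpos
    · left; rw [e2, h0, mul_zero]
    · right
      have : K + 1 ≤ β := by rw [e2]; exact Nat.le_mul_of_pos_right _ hpos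
      omega
  rcases hβ0L with h0 | hK
  · left; rw [hβ, h0, mul_zero]
  · right
    have : d₁ = K * (K + 1) := by rw [hβ, hK]
    have h' : (K + 1) * K = K * (K + 1) := Nat.mul_comm _ _
    omega

end BlockTypes

end Summit.MatrixMultiplication.MatrixMultiplication.Theorems.ObstructionDescentDominance
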